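import Mathlib
import HarnessLib
import Summits.HubbardSuperconductivity.HubbardSuperconductivity.Theorems.KLProgrammeKLRegimeTwoVolumeTowerBaseGridMom
import Summits.HubbardSuperconductivity.HubbardSuperconductivity.Theorems.KLProgrammeKLRegimeTwoVolumeTowerBaseGridBoundScaled
import Summits.HubbardSuperconductivity.HubbardSuperconductivity.Theorems.KLProgrammeKLRegimeTwoVolumeTowerBaseGridDataMDefs
import Summits.HubbardSuperconductivity.HubbardSuperconductivity.Theorems.KLProgrammeKLRegimeTwoVolumeTowerBase
import Summits.HubbardSuperconductivity.HubbardSuperconductivity.Theorems.KLProgrammeKLRegimeTwoVolumeTowerBaseGridLimit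

/-!
# Route `KLProgramme` — crux K3, VL child `KLRegimeVolumeLimitV17F2` (stmt-HubbardSuperconductivity-20440), atom HB1 (grid half), cure of «GRID-CT-BUDGET»:
# THE GRID-LEVEL BASE OF THE SPINE, EVENTUALLY IN `L`, FROM `TowerGridDataM` (first-moment counterterm glue budget)
# (cell gate-hubbard-kl, seat p3 g18; twin of k3c4-p1 g13's `…TowerBaseGridLimitDeg`; `--supports` 20440)

Twin of `…TowerBaseGridLimitDeg` (k3c4-p1) for the data package `…TowerBaseGridDataMDefs.TowerGridDataM` (counterterm glue budget at the position first
moments, so NO degree cap: the glue-term rate is `(1 + 0)/(R′+2)`, which tends to `0` by the hypothesis `hq'0` alone — `hq0` disappears from the interface)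
and the one-instance defect `…TowerBaseGridMom.tower_base_grid_keyedDefect_le_mom` (M4a‴).  Row-type constants `∝ 1/ε_M` as the suppliers deliver them; the
bookkeeping `…TowerBaseGridBoundScaled.tower_base_grid_rhs_le_eps_mul_scaled` is reused verbatim at `D₀ := 0`.

* **`tower_base_grid_keyedDefect_eventually_le_mom`** — EXACTLY the hypothesis `hgrid` of `…TowerBase.tower_base_keyedDefect_eventually_le`;
* **`tower_base_h0_eventually_le_mom`** — composed with it;
* **`towerData_h0_of_baseDataM`** — at the flow frames / `Mth`-admissibility / `imagTimeWeight` (literally the field `h0` of `TowerData β U μ`).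

Proofs only; no definition.  Honest framing: bookkeeping; nothing asserts HB1, any stub, K3, VL or superconductivity.
[cite: BenfattoGiulianiMastropietro2006, §2 (2.13)–(2.14), (2.77)–(2.80), §3 (3.3)]
-/

noncomputable section

namespace Summit.HubbardSuperconductivity.HubbardSuperconductivity.Theorems.TwoVolumeSource

set_option linter.dupNamespace false -- summit = problem name (single-conjunct summit), D-0017

open Finset Filter Topology Literature.MathematicalPhysics.QuantumLattice GrassmannAlgebra Literature.Probability.LatticeModels
  Literature.Probability.LatticeModels.BattleFederbush
open Literature.MathematicalPhysics.QuantumLattice.FermiRG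
open Summit.HubbardSuperconductivity.HubbardSuperconductivity.Theorems.KLProgrammeLegKernels
open Summit.HubbardSuperconductivity.HubbardSuperconductivity.Theorems.KLRegimeSplit
open Summit.HubbardSuperconductivity.HubbardSuperconductivity.Theorems.TwoPointAssembly
open Summit.HubbardSuperconductivity.HubbardSuperconductivity.Theorems.EngineV8
open Summit.HubbardSuperconductivity.HubbardSuperconductivity.Theorems.TwoVolumeDefect

set_option maxHeartbeats 1600000 in -- one large instantiation per summand, then a finite-sum limit
/-- **THE GRID-LEVEL BASE OF THE SPINE, EVENTUALLY IN `L`, from data in the GRID SCALING**: eventually-in-`L` `TowerGridDataM` at volume-free constants, with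
the rates `sE, cc, eE, tT, Te → 0` and radii `R + R′ ≤ r`, `(1+R)/(R′+2) → 0`, `(R′+1)⁻¹ → 0`, give EXACTLY the hypothesis `hgrid` of
`…TowerBase.tower_base_keyedDefect_eventually_le`.  (M4a and the frame swap are instantiated with `α := a/ε_M`, `αw := aw/ε_M`, `T := tT_L/ε_M`, ….)
[folklore: `tower_base_grid_keyedDefect_le` + `tower_base_grid_rhs_le_eps_mul_scaled` + finite-sum limits] -/
theorem tower_base_grid_keyedDefect_eventually_le_mom (β U μ : ℝ) (hβ : 0 < β) (Kfr : ℕ → ℕ → TrigPolyC4v) (Adm : ℕ → ℕ → ℕ → Prop) (ε : ℕ → ℝ)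
    (hε : ∀ L b M, Adm L b M → 0 < ε M) (r : ℕ → ℕ)
    {κE aC cb κ κ' ρS ρ' ρ₂ ρf aw al al' mo mo' s s' Θ νW νf ν₂ νD : ℝ}
    (hκE : 0 < κE) (haC : 0 < aC) (hκ : 0 < κ) (hκ' : 0 < κ') (hρS : 0 < ρS) (hρ' : 0 < ρ') (hρ₂ : 0 < ρ₂) (hρf : 0 < ρf) (haw : 0 < aw)
    (haa : 0 < al' + al) (hm0 : 0 ≤ mo) (hm0' : 0 ≤ mo') (hs0 : 0 ≤ s) (hs'0 : 0 ≤ s') (hΘ0 : 0 ≤ Θ) (hνW0 : 0 ≤ νW) (hνf0 : 0 ≤ νf) (hν₂0 : 0 ≤ ν₂)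
    (hθS : Real.exp 1 * (aC + cb) * νW / κE ^ 2 < 1) (hθΘ : Real.exp 1 * aw * Θ / κ' ^ 2 < 1)
    (hθf : Real.exp 1 * (al' + al + (mo' + mo)) * νf / (κ' + κ) ^ 2 < 1) (hθ₂ : Real.exp 1 * (al' + al + (mo' + mo)) * ν₂ / (κ' + κ + (κ' + κ + (κ' + κ))) ^ 2 < 1)
    (sE cc eE tT Te : ℕ → ℝ) (R R' : ℕ → ℕ)
    (hrate : ∀ L, 0 ≤ sE L ∧ 0 ≤ cc L ∧ 2 * cc L ≤ cb ∧ 0 < tT L ∧ 0 ≤ Te L)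
    (hsE0 : Tendsto sE atTop (𝓝 0)) (hcc0 : Tendsto cc atTop (𝓝 0)) (heE0 : Tendsto eE atTop (𝓝 0)) (htT0 : Tendsto tT atTop (𝓝 0))
    (hTe0 : Tendsto Te atTop (𝓝 0))
    (hq'0 : Tendsto (fun L => ((R' L : ℝ) + 1)⁻¹) atTop (𝓝 0))
    (hRR : ∀ L, R L + R' L ≤ r L)
    (hdata : ∀ᶠ L in atTop, ∀ (b M : ℕ) [NeZero L] [NeZero (b * L)] [NeZero M], Adm L b M →
      Nonempty (TowerGridDataM L b M β U μ (Kfr L M) (Kfr (b * L) M) (ε M) κE aC κ κ' ρS ρ' ρ₂ ρf aw al al' mo mo' s s' Θ νW νf ν₂ νD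
        (sE L) (cc L) (eE L) (tT L) (Te L) (R L) (R' L))) :
    ∀ (k : ℕ) (η : ℝ), 0 < η → ∀ᶠ L in atTop, ∀ (b M : ℕ) [NeZero L] [NeZero (b * L)] [NeZero M], Adm L b M →
      ∀ (p' : Fin k) (y' : GridLeg (GridPoint (b * L) (klGridN M))), (∀ i, r L ≤ (y'.1.1.2 i).val % L ∧ (y'.1.1.2 i).val % L + r L < L) →
        ∑ Y' ∈ univ.filter (fun Y' : Fin k → GridLeg (GridPoint (b * L) (klGridN M)) => Y' p' = y'),
          ‖kernel ℂ (klGridAction (b * L) M β U μ (Kfr (b * L) M)) k Y' -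
            (if ∀ i, (klGridBlockEquiv L b M (Y' i)).1 = (klGridBlockEquiv L b M (Y' p')).1 then
              kernel ℂ (klGridAction L M β U μ (Kfr L M)) k (fun i => (klGridBlockEquiv L b M (Y' i)).2) else 0)‖ ≤ ε M * η := by
  intro k η hη
  cases k with
  | zero => exact Filter.Eventually.of_forall fun L b M _ _ _ _ p' => p'.elim0
  | succ n =>
    -- the counterterm glue term's rate: `(1 + 0)/(R′+2) ≤ (R′+1)⁻¹ → 0`
    have hq0 : Tendsto (fun L => (1 + ((0 : ℕ) : ℝ)) / (1 + ((R' L : ℝ) + 1))) atTop (𝓝 0) := by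
      refine squeeze_zero (fun L => by positivity) (fun L => ?_) hq'0
      rw [Nat.cast_zero, add_zero, one_div]
      exact inv_anti₀ (by positivity) (by linarith)
    have hΦ : Tendsto (fun L => (sE L * (((((n + 1 + 1) * (n + 1 + 2) : ℕ) : ℝ) / 2) * (ρS⁻¹ ^ (n + 3) * (Real.exp 1 * νW) / (1 - Real.exp 1 * (aC + cb) * νW / κE ^ 2))) + (2 * cc L) * (‖(2 : ℂ)⁻¹‖ * ∑ a' ∈ range (n + 2), ∑ b' ∈ range (n + 2), (if a' + b' = n + 1 then (((a' + 1) * (b' + 1) : ℕ) : ℝ) * ((ρS⁻¹ ^ (a' + 1) * (Real.exp 1 * νW) / (1 - Real.exp 1 * (aC + cb) * νW / κE ^ 2)) * (ρS⁻¹ ^ (b' + 1) * (Real.exp 1 * νW) / (1 - Real.exp 1 * (aC + cb) * νW / κE ^ 2))) else 0)) + eE L * (ρ'⁻¹ ^ (n + 1) * Real.exp 1 / (1 - Real.exp 1 * aw * Θ / κ' ^ 2) ^ 2) + (1 + ((0 : ℕ) : ℝ)) / (1 + ((R' L : ℝ) + 1)) * (ρ'⁻¹ ^ (n + 1) * (Real.exp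 1 * νD) / (1 - Real.exp 1 * aw * Θ / κ' ^ 2) ^ 2) + Te L * (((((n + 1 + 1) * (n + 1 + 2) : ℕ) : ℝ) / 2) * (ρ₂⁻¹ ^ (n + 3) * (Real.exp 1 * ν₂) / (1 - Real.exp 1 * (al' + al + (mo' + mo)) * ν₂ / (κ' + κ + (κ' + κ + (κ' + κ))) ^ 2))) + tT L * (‖(2 : ℂ)⁻¹‖ * ∑ a ∈ range (n + 2), ∑ b' ∈ range (n + 2), (if a + b' = n + 1 then (((a + 1) * (b' + 1) : ℕ) : ℝ) * (4 * (ρ₂⁻¹ ^ (a + 1) * (Real.exp 1 * ν₂) / (1 - Real.exp 1 * (al' + al + (mo' + mo)) * ν₂ / (κ' + κ + (κ' + κ + (κ' + κ))) ^ 2)) * (ρ₂⁻¹ ^ (b' + 1) * (Real.exp 1 * ν₂) / (1 - Real.exp 1 * (al' + al + (mo' + mo)) * ν₂ / (κ' + κ + (κ' + κ + (κ' + κ))) ^ 2))) else 0)) + ((R' L : ℝ) + 1)⁻¹ * (((((n + 1 + 1) * (n + 1 + 2) : ℕ) : ℝ) / 2) * (s' + s) * (ρf⁻¹ ^ (n +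 3) * (Real.exp 1 * νf) / (1 - Real.exp 1 * (al' + al + (mo' + mo)) * νf / (κ' + κ) ^ 2)) + ‖(2 : ℂ)⁻¹‖ * ∑ a ∈ range (n + 2), ∑ b' ∈ range (n + 2), (if a + b' = n + 1 then (((a + 1) * (b' + 1) : ℕ) : ℝ) * (2 * (al' + al + (mo' + mo)) * (ρf⁻¹ ^ (a + 1) * (Real.exp 1 * νf) / (1 - Real.exp 1 * (al' + al + (mo' + mo)) * νf / (κ' + κ) ^ 2)) * (ρf⁻¹ ^ (b' + 1) * (Real.exp 1 * νf) / (1 - Real.exp 1 * (al' + al + (mo' + mo)) * νf / (κ' + κ) ^ 2))) else 0)))) atTop (𝓝 0) := by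
      have h := ((((((hsE0.mul_const (((((n + 1 + 1) * (n + 1 + 2) : ℕ) : ℝ) / 2) * (ρS⁻¹ ^ (n + 3) * (Real.exp 1 * νW) / (1 - Real.exp 1 * (aC + cb) * νW / κE ^ 2)))).add ((hcc0.const_mul 2).mul_const (‖(2 : ℂ)⁻¹‖ * ∑ a' ∈ range (n + 2), ∑ b' ∈ range (n + 2), (if a' + b' = n + 1 then (((a' + 1) * (b' + 1) : ℕ) : ℝ) * ((ρS⁻¹ ^ (a' + 1) * (Real.exp 1 * νW) / (1 - Real.exp 1 * (aC + cb) * νW / κE ^ 2)) * (ρS⁻¹ ^ (b' + 1) * (Real.exp 1 * νW) / (1 - Real.exp 1 * (aC + cb) * νW / κE ^ 2))) else 0)))).add (heE0.mul_const (ρ'⁻¹ ^ (n + 1) * Real.exp 1 / (1 - Real.exp 1 * aw * Θ / κ' ^ 2) ^ 2))).add (hq0.mul_const (ρ'⁻¹ ^ (n + 1) * (Real.exp 1 * νD) / (1 - Real.exp 1 * aw * Θ / κ' ^ 2) ^ 2))).add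
        (hTe0.mul_const (((((n + 1 + 1) * (n + 1 + 2) : ℕ) : ℝ) / 2) * (ρ₂⁻¹ ^ (n + 3) * (Real.exp 1 * ν₂) / (1 - Real.exp 1 * (al' + al + (mo' + mo)) * ν₂ / (κ' + κ + (κ' + κ + (κ' + κ))) ^ 2))))).add (htT0.mul_const (‖(2 : ℂ)⁻¹‖ * ∑ a ∈ range (n + 2), ∑ b' ∈ range (n + 2), (if a + b' = n + 1 then (((a + 1) * (b' + 1) : ℕ) : ℝ) * (4 * (ρ₂⁻¹ ^ (a + 1) * (Real.exp 1 * ν₂) / (1 - Real.exp 1 * (al' + al + (mo' + mo)) * ν₂ / (κ' + κ + (κ' + κ + (κ' + κ))) ^ 2)) * (ρ₂⁻¹ ^ (b' + 1) * (Real.exp 1 * ν₂) / (1 - Real.exp 1 * (al' + al + (mo' + mo)) * ν₂ / (κ' + κ + (κ' + κ + (κ' + κ))) ^ 2))) else 0)))).add (hq'0.mul_const (((((n + 1 + 1) * (n + 1 + 2) : ℕ) : ℝ) / 2) * (s' + s) * (ρf⁻¹ ^ (n + 3) * (Real.exp 1 * νf) / (1 - Real.exp 1 * (al' + al + (mo'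 + mo)) * νf / (κ' + κ) ^ 2)) + ‖(2 : ℂ)⁻¹‖ * ∑ a ∈ range (n + 2), ∑ b' ∈ range (n + 2), (if a + b' = n + 1 then (((a + 1) * (b' + 1) : ℕ) : ℝ) * (2 * (al' + al + (mo' + mo)) * (ρf⁻¹ ^ (a + 1) * (Real.exp 1 * νf) / (1 - Real.exp 1 * (al' + al + (mo' + mo)) * νf / (κ' + κ) ^ 2)) * (ρf⁻¹ ^ (b' + 1) * (Real.exp 1 * νf) / (1 - Real.exp 1 * (al' + al + (mo' + mo)) * νf / (κ' + κ) ^ 2))) else 0)))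
      simpa only [zero_mul, mul_zero, add_zero, zero_add] using h
    filter_upwards [hdata, hΦ.eventually (eventually_lt_nhds hη)] with L hL hΦL
    intro b M _ _ _ hadm p' y' hy'
    obtain ⟨D⟩ := hL b M hadm
    have hε0 : 0 < ε M := hε L b M hadm
    have hεne : ε M ≠ 0 := hε0.ne'
    obtain ⟨hsE, hcc, hccb, htT, hTe⟩ := hrate L
    classical
    -- parity / constant part of the fine grid interaction, a crude raw profile
    have hXe : hubbardGridInteraction (b * L) (klGridN M) β U + hubbardGridCounterQuadratic (b * L) (klGridN M) β (Kfr (b * L) M) ∈ evenOdd ℂ 0 :=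
      mem_evenPart_iff.1 (add_mem (hubbardGridInteraction_mem_evenPart β U) (hubbardGridCounterQuadratic_mem_evenPart β (Kfr (b * L) M)))
    have hX0 : constPart ℂ (hubbardGridInteraction (b * L) (klGridN M) β U + hubbardGridCounterQuadratic (b * L) (klGridN M) β (Kfr (b * L) M)) = 0 := by
      rw [map_add, constPart_hubbardGridInteraction, constPart_hubbardGridCounterQuadratic, add_zero]
    have hNX : ∀ (k : ℕ) (p : Fin k) (y : GridLeg (GridPoint (b * L) (klGridN M))), ∑ Y ∈ univ.filter (fun Y : Fin k → GridLeg (GridPoint (b * L) (klGridN M)) => Y p = y),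
        ‖kernel ℂ (hubbardGridInteraction (b * L) (klGridN M) β U + hubbardGridCounterQuadratic (b * L) (klGridN M) β (Kfr (b * L) M)) k Y‖ ≤
        (fun k => ∑ Y : Fin k → GridLeg (GridPoint (b * L) (klGridN M)), ‖kernel ℂ (hubbardGridInteraction (b * L) (klGridN M) β U + hubbardGridCounterQuadratic (b * L) (klGridN M) β (Kfr (b * L) M)) k Y‖) k :=
      fun k p y => sum_le_sum_of_subset_of_nonneg (filter_subset _ _) fun _ _ _ => norm_nonneg _
    -- un-scaling: `ε·Σ ≤ c` ⇒ `Σ ≤ c/ε`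
    have unsc : ∀ (S c : ℝ), ε M * S ≤ c → S ≤ c / ε M := fun S c h => (le_div_iff₀ hε0).2 ((mul_comm S (ε M)).le.trans h)
    -- the instance smallness conditions from the volume-free ones
    have hXW0 : 0 ≤ normV (GridLeg (GridPoint (b * L) (klGridN M))) κE ρS D.NW := normV_nonneg hκE.le hρS.le D.hNW0
    have hXf0 : 0 ≤ normV (GridLeg (GridPoint (b * L) (klGridN M))) (κ' + κ) ρf D.Nw := normV_nonneg (by positivity) hρf.le D.hNw0
    have hX20 : 0 ≤ normV (GridLeg (GridPoint (b * L) (klGridN M))) (κ' + κ + (κ' + κ + (κ' + κ))) ρ₂ D.Nw := normV_nonneg (by positivity) hρ₂.le D.hNw0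
    have he0 : 0 < Real.exp 1 := Real.exp_pos 1
    have haa' : 0 < al' / ε M + al / ε M := by rw [← add_div]; exact div_pos haa hε0
    have hAM0 : 0 ≤ Real.exp 1 * (al' / ε M + al / ε M + (mo' / ε M + mo / ε M)) :=
      mul_nonneg he0.le (add_nonneg haa'.le (add_nonneg (div_nonneg hm0' hε0.le) (div_nonneg hm0 hε0.le)))
    have hθS₁ : Real.exp 1 * (aC / ε M + (cc L / ε M + cc L / ε M)) * normV (GridLeg (GridPoint (b * L) (klGridN M))) κE ρS D.NW / κE ^ 2 < 1 := by
      refine lt_of_le_of_lt (div_le_div_of_nonneg_right ?_ (sq_nonneg _)) hθS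
      calc Real.exp 1 * (aC / ε M + (cc L / ε M + cc L / ε M)) * normV (GridLeg (GridPoint (b * L) (klGridN M))) κE ρS D.NW ≤ Real.exp 1 * (aC / ε M + (cc L / ε M + cc L / ε M)) * (ε M * νW) :=
            mul_le_mul_of_nonneg_left D.hνW (by positivity)
        _ = Real.exp 1 * (aC + 2 * cc L) * νW := by field_simp; ring
        _ ≤ Real.exp 1 * (aC + cb) * νW := mul_le_mul_of_nonneg_right (mul_le_mul_of_nonneg_left (by linarith) he0.le) hνW0
    have hθS₂ : Real.exp 1 * (aC / ε M) * normV (GridLeg (GridPoint (b * L) (klGridN M))) κE ρS D.NW / κE ^ 2 < 1 := by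
      refine lt_of_le_of_lt (div_le_div_of_nonneg_right ?_ (sq_nonneg _)) hθS
      calc Real.exp 1 * (aC / ε M) * normV (GridLeg (GridPoint (b * L) (klGridN M))) κE ρS D.NW ≤ Real.exp 1 * (aC / ε M) * (ε M * νW) := mul_le_mul_of_nonneg_left D.hνW (by positivity)
        _ = Real.exp 1 * aC * νW := by field_simp
        _ ≤ Real.exp 1 * (aC + cb) * νW := mul_le_mul_of_nonneg_right (mul_le_mul_of_nonneg_left (by linarith) he0.le) hνW0
    have hθw : Real.exp 1 * (al' / ε M + al / ε M + (mo' / ε M + mo / ε M)) * normV (GridLeg (GridPoint (b * L) (klGridN M))) (κ' + κ) ρf D.Nw / (κ' + κ) ^ 2 < 1 := by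
      refine lt_of_le_of_lt (div_le_div_of_nonneg_right ?_ (sq_nonneg _)) hθf
      calc Real.exp 1 * (al' / ε M + al / ε M + (mo' / ε M + mo / ε M)) * normV (GridLeg (GridPoint (b * L) (klGridN M))) (κ' + κ) ρf D.Nw ≤ Real.exp 1 * (al' / ε M + al / ε M + (mo' / ε M + mo / ε M)) * (ε M * νf) :=
            mul_le_mul_of_nonneg_left D.hνf hAM0
        _ = Real.exp 1 * (al' + al + (mo' + mo)) * νf := by field_simp
    have hθ₂i : Real.exp 1 * (al' / ε M + al / ε M + (mo' / ε M + mo / ε M)) * normV (GridLeg (GridPoint (b * L) (klGridN M))) (κ' + κ + (κ' + κ + (κ' + κ))) ρ₂ D.Nw / (κ' + κ + (κ' + κ + (κ' + κ))) ^ 2 < 1 := by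
      refine lt_of_le_of_lt (div_le_div_of_nonneg_right ?_ (sq_nonneg _)) hθ₂
      calc Real.exp 1 * (al' / ε M + al / ε M + (mo' / ε M + mo / ε M)) * normV (GridLeg (GridPoint (b * L) (klGridN M))) (κ' + κ + (κ' + κ + (κ' + κ))) ρ₂ D.Nw ≤ Real.exp 1 * (al' / ε M + al / ε M + (mo' / ε M + mo / ε M)) * (ε M * ν₂) :=
            mul_le_mul_of_nonneg_left D.hν₂ hAM0
        _ = Real.exp 1 * (al' + al + (mo' + mo)) * ν₂ := by field_simp
    have hbar : Real.exp 1 * (aw / ε M) * (normV (GridLeg (GridPoint (b * L) (klGridN M))) κ' ρ' (fun m' => D.NV m' + D.ND m') + normV (GridLeg (GridPoint (b * L) (klGridN M))) κ' ρ' D.E) / κ' ^ 2 < 1 := by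
      refine lt_of_le_of_lt (div_le_div_of_nonneg_right ?_ (sq_nonneg _)) hθΘ
      calc Real.exp 1 * (aw / ε M) * (normV (GridLeg (GridPoint (b * L) (klGridN M))) κ' ρ' (fun m' => D.NV m' + D.ND m') + normV (GridLeg (GridPoint (b * L) (klGridN M))) κ' ρ' D.E)
          ≤ Real.exp 1 * (aw / ε M) * (ε M * Θ) := mul_le_mul_of_nonneg_left D.hΘ1 (by positivity)
        _ = Real.exp 1 * aw * Θ := by field_simp
    have hθ₂' : Real.exp 1 * (aw / ε M) * (normV (GridLeg (GridPoint (b * L) (klGridN M))) κ' ρ' D.NV + normV (GridLeg (GridPoint (b * L) (klGridN M))) κ' ρ' D.ND) / κ' ^ 2 < 1 := by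
      refine lt_of_le_of_lt (div_le_div_of_nonneg_right ?_ (sq_nonneg _)) hθΘ
      calc Real.exp 1 * (aw / ε M) * (normV (GridLeg (GridPoint (b * L) (klGridN M))) κ' ρ' D.NV + normV (GridLeg (GridPoint (b * L) (klGridN M))) κ' ρ' D.ND)
          ≤ Real.exp 1 * (aw / ε M) * (ε M * Θ) := mul_le_mul_of_nonneg_left D.hΘ2 (by positivity)
        _ = Real.exp 1 * aw * Θ := by field_simp
    have hw : ∀ j, R L + R' L ≤ (y'.1.1.2 j).val % L ∧ (y'.1.1.2 j).val % L + (R L + R' L) < L := fun j =>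
      ⟨(hRR L).trans (hy' j).1, lt_of_le_of_lt (Nat.add_le_add_left (hRR L) _) (hy' j).2⟩
    -- the one-instance defect (M3f-swap + M4a + splice) at the un-scaled numbers
    have hmain := tower_base_grid_keyedDefect_le_mom hβ μ (Kfr L M) (Kfr (b * L) M) _ rfl _ rfl _ rfl hκE D.hGBE (div_pos haC hε0)
      (fun x => unsc _ _ (D.hrowC x)) (fun y => unsc _ _ (D.hcolC y)) (div_nonneg hcc hε0.le) (div_nonneg hcc hε0.le) D.hsE (fun x => unsc _ _ (D.hR x)) (fun y => unsc _ _ (D.hCc y))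
      U hXe hX0 (fun k => ∑ Y : Fin k → GridLeg (GridPoint (b * L) (klGridN M)),
        ‖kernel ℂ (hubbardGridInteraction (b * L) (klGridN M) β U + hubbardGridCounterQuadratic (b * L) (klGridN M) β (Kfr (b * L) M)) k Y‖)
      (fun k => sum_nonneg fun _ _ => norm_nonneg _) hNX D.NW D.hNW0 D.hNW hρS hθS₁ hθS₂ (R L) (R' L) D.hRK y' hw (div_pos htT hε0)
      (fun X' => unsc _ _ (D.hT X')) D.hsec hs0 hs'0 D.hs D.hs' haa' (fun X => unsc _ _ (D.hrow X)) (fun X' => unsc _ _ (D.hrow' X')) (div_nonneg hm0 hε0.le) (div_nonneg hm0' hε0.le)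
      (fun X => unsc _ _ (D.hm1 X)) (fun X' => unsc _ _ (D.hm1' X')) hκ hκ' D.hGB D.hGB' D.hZ D.Nw D.hNw0 D.hNw hρf hθw hρ₂ hθ₂i (div_pos haw hε0)
      (fun X' => unsc _ _ (D.hroww X')) (fun Y' => unsc _ _ (D.hcolw Y')) D.NV D.ND D.E D.hNV0 D.hND0 D.hE0 D.hNV D.hND D.hE hρ' le_rfl hbar hθ₂' n p'
    -- its `ε ×` form
    have hrhs := tower_base_grid_rhs_le_eps_mul_scaled (GridLeg (GridPoint (b * L) (klGridN M))) n hε0.le hsE (div_nonneg hcc hε0.le) (div_nonneg hcc hε0.le)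
      (le_of_eq (by field_simp; ring) : ε M * (cc L / ε M + cc L / ε M) ≤ 2 * cc L) hccb (div_nonneg haC.le hε0.le) (le_of_eq (by field_simp) : ε M * (aC / ε M) ≤ aC)
      hκE hρS D.hNW0 hνW0 D.hνW hθS 0 (R' L) hκ hκ' hρ' hρ₂ hρf (div_nonneg haw.le hε0.le) (le_of_eq (by field_simp) : ε M * (aw / ε M) ≤ aw)
      haa'.le (add_nonneg (div_nonneg hm0' hε0.le) (div_nonneg hm0 hε0.le))
      (le_of_eq (by field_simp) : ε M * (al' / ε M + al / ε M + (mo' / ε M + mo / ε M)) ≤ (al' + al + (mo' + mo))) (add_nonneg hs'0 hs0)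
      (div_nonneg htT.le hε0.le) (le_of_eq (by field_simp) : ε M * (tT L / ε M) ≤ tT L) hTe D.hNw0 D.hND0 D.hE0 D.heE (show normV (GridLeg (GridPoint (b * L) (klGridN M))) κ' ρ' D.ND ≤ ε M * ((1 + ((0 : ℕ) : ℝ)) * νD) from
        D.hνD.trans (le_of_eq (by push_cast; ring))) D.hΘ1 D.hΘ2 hΘ0 hθΘ
      hνf0 D.hνf hθf hν₂0 D.hν₂ hθ₂
    exact (hmain.trans hrhs).trans (mul_le_mul_of_nonneg_left hΦL.le hε0.le)

/-- **THE BASE FIELD `h0` FROM THE BASE-TRANSFER DATA AND THE GRID DATA IN THE GRID SCALING** (composition of `…TowerBase.tower_base_keyedDefect_eventually_le`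
with `tower_base_grid_keyedDefect_eventually_le_mom`). [folklore] -/
theorem tower_base_h0_eventually_le_mom (β U μ : ℝ) (hβ : 0 < β) (Kfr : ℕ → ℕ → TrigPolyC4v) (Adm : ℕ → ℕ → ℕ → Prop) (ε : ℕ → ℝ)
    (hε : ∀ L b M, Adm L b M → 0 < ε M) (r : ℕ → ℕ) (hr : Tendsto r atTop atTop)
    -- the base-transfer data of `…TowerBase`
    {ΛT cW Λg δb : ℝ} (hΛT : 0 < ΛT) (hcW : 0 ≤ cW) (hΛg : 0 < Λg) (NG : ℕ → ℝ) (hNG0 : ∀ k, 0 ≤ NG k)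
    (δ : ℕ → ℝ) (hδ : ∀ L, 0 ≤ δ L ∧ δ L ≤ δb) (hδ0 : Tendsto δ atTop (𝓝 0))
    (hdataT : ∀ᶠ L in atTop, ∀ (b M : ℕ) [NeZero L] [NeZero (b * L)] [NeZero M], Adm L b M →
      (∀ x : SrcLabel (b * L) M 0, ∑ y, ‖klBaseTransfer (b * L) M β μ (Kfr L M) x y‖ * (1 + ΛT * (Torus.tnorm (x.1.1.2 - y.1.1.1.2) : ℝ)) ≤ cW) ∧
      (∀ y : GridLeg (GridPoint (b * L) (klGridN M)) × Fin 2, ∑ x, ‖klBaseTransfer (b * L) M β μ (Kfr L M) x y‖ * (1 + ΛT * (Torus.tnorm (x.1.1.2 - y.1.1.1.2) : ℝ)) ≤ cW) ∧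
      (∀ (δ' β' β₁ : Fin 2 → Fin b) (xbar : SrcLabel L M 0) (y : GridLeg (GridPoint L (klGridN M)) × Fin 2),
        ‖klBaseTransfer (b * L) M β μ (Kfr L M) ((klBlockEquivD L b M 0).symm (β' + δ', xbar)) ((klGridBlockEquivD L b M).symm (β₁ + δ', y))‖ =
          ‖klBaseTransfer (b * L) M β μ (Kfr L M) ((klBlockEquivD L b M 0).symm (β', xbar)) ((klGridBlockEquivD L b M).symm (β₁, y))‖) ∧
      (∀ x, ∑ y, ‖klBaseTransfer (b * L) M β μ (Kfr (b * L) M) x y - klBaseTransfer (b * L) M β μ (Kfr L M) x y‖ ≤ δ L) ∧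
      (∀ y, ∑ x, ‖klBaseTransfer (b * L) M β μ (Kfr (b * L) M) x y - klBaseTransfer (b * L) M β μ (Kfr L M) x y‖ ≤ δ L) ∧
      (∀ (k : ℕ) (p : Fin k) (y : GridLeg (GridPoint L (klGridN M))),
        ∑ Y ∈ univ.filter (fun Y : Fin k → GridLeg (GridPoint L (klGridN M)) => Y p = y),
          ‖kernel ℂ (klGridAction L M β U μ (Kfr L M)) k Y‖ *
            (1 + labelDiam (fun Y₁ Y₂ : GridLeg (GridPoint L (klGridN M)) => Λg * (Torus.tnorm (Y₁.1.1.2 - Y₂.1.1.2) : ℝ)) (univ.image Y)) ≤ ε M * NG k) ∧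
      (∀ (k : ℕ) (p : Fin k) (y : GridLeg (GridPoint (b * L) (klGridN M))),
        ∑ Y ∈ univ.filter (fun Y : Fin k → GridLeg (GridPoint (b * L) (klGridN M)) => Y p = y),
          ‖kernel ℂ (klGridAction (b * L) M β U μ (Kfr (b * L) M)) k Y‖ *
            (1 + labelDiam (fun Y₁ Y₂ : GridLeg (GridPoint (b * L) (klGridN M)) => Λg * (Torus.tnorm (Y₁.1.1.2 - Y₂.1.1.2) : ℝ)) (univ.image Y)) ≤ ε M * NG k))
    -- the grid data, grid scaling
    {κE aC cb κ κ' ρS ρ' ρ₂ ρf aw al al' mo mo' s s' Θ νW νf ν₂ νD : ℝ}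
    (hκE : 0 < κE) (haC : 0 < aC) (hκ : 0 < κ) (hκ' : 0 < κ') (hρS : 0 < ρS) (hρ' : 0 < ρ') (hρ₂ : 0 < ρ₂) (hρf : 0 < ρf) (haw : 0 < aw)
    (haa : 0 < al' + al) (hm0 : 0 ≤ mo) (hm0' : 0 ≤ mo') (hs0 : 0 ≤ s) (hs'0 : 0 ≤ s') (hΘ0 : 0 ≤ Θ) (hνW0 : 0 ≤ νW) (hνf0 : 0 ≤ νf) (hν₂0 : 0 ≤ ν₂)
    (hθS : Real.exp 1 * (aC + cb) * νW / κE ^ 2 < 1) (hθΘ : Real.exp 1 * aw * Θ / κ' ^ 2 < 1)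
    (hθf : Real.exp 1 * (al' + al + (mo' + mo)) * νf / (κ' + κ) ^ 2 < 1) (hθ₂ : Real.exp 1 * (al' + al + (mo' + mo)) * ν₂ / (κ' + κ + (κ' + κ + (κ' + κ))) ^ 2 < 1)
    (sE cc eE tT Te : ℕ → ℝ) (R R' : ℕ → ℕ)
    (hrate : ∀ L, 0 ≤ sE L ∧ 0 ≤ cc L ∧ 2 * cc L ≤ cb ∧ 0 < tT L ∧ 0 ≤ Te L)
    (hsE0 : Tendsto sE atTop (𝓝 0)) (hcc0 : Tendsto cc atTop (𝓝 0)) (heE0 : Tendsto eE atTop (𝓝 0)) (htT0 : Tendsto tT atTop (𝓝 0))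
    (hTe0 : Tendsto Te atTop (𝓝 0))
    (hq'0 : Tendsto (fun L => ((R' L : ℝ) + 1)⁻¹) atTop (𝓝 0))
    (hRR : ∀ L, R L + R' L ≤ r L)
    (hdata : ∀ᶠ L in atTop, ∀ (b M : ℕ) [NeZero L] [NeZero (b * L)] [NeZero M], Adm L b M →
      Nonempty (TowerGridDataM L b M β U μ (Kfr L M) (Kfr (b * L) M) (ε M) κE aC κ κ' ρS ρ' ρ₂ ρf aw al al' mo mo' s s' Θ νW νf ν₂ νD
        (sE L) (cc L) (eE L) (tT L) (Te L) (R L) (R' L))) :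
    ∀ (k : ℕ) (η : ℝ), 0 < η → ∀ᶠ L in atTop, ∀ (b M : ℕ) [NeZero L] [NeZero (b * L)] [NeZero M], Adm L b M →
      ∀ (p : Fin k) (w : SrcLabel (b * L) M 0), (∀ i, 2 * r L ≤ (w.1.1.2 i).val % L ∧ (w.1.1.2 i).val % L + 2 * r L < L) →
        klKeyedDefect L b M β U μ (Kfr L M) (Kfr (b * L) M) 0 k p w ≤ ε M * η :=
  tower_base_keyedDefect_eventually_le β U μ hβ.ne' Kfr Adm ε hε r hr hΛT hcW hΛg NG hNG0 δ hδ hδ0 hdataT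
    (tower_base_grid_keyedDefect_eventually_le_mom β U μ hβ Kfr Adm ε hε r hκE haC hκ hκ' hρS hρ' hρ₂ hρf haw haa hm0 hm0' hs0 hs'0 hΘ0 hνW0 hνf0 hν₂0
      hθS hθΘ hθf hθ₂ sE cc eE tT Te R R' hrate hsE0 hcc0 heE0 htT0 hTe0 hq'0 hRR hdata)

/-- **THE FIELD `h0` OF `TowerData β U μ` FROM THE BASE-TRANSFER DATA AND THE GRID DATA (GRID SCALING) AT THE FLOW FRAMES** — `tower_base_h0_eventually_le_mom`
with admissibility `Mth L b ≤ M`, normalisation `ε_M = imagTimeWeight β M` and the flow frames substituted. [folklore] -/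
theorem towerData_h0_of_baseDataM (β U μ : ℝ) (hβ : 0 < β) (Mth : ℕ → ℕ → ℕ)
    (hMth : ∀ L b M, Mth L b ≤ M → 0 < imagTimeWeight β M) (r : ℕ → ℕ) (hr : Tendsto r atTop atTop)
    -- the base-transfer data of `…TowerBase`
    {ΛT cW Λg δb : ℝ} (hΛT : 0 < ΛT) (hcW : 0 ≤ cW) (hΛg : 0 < Λg) (NG : ℕ → ℝ) (hNG0 : ∀ k, 0 ≤ NG k)
    (δ : ℕ → ℝ) (hδ : ∀ L, 0 ≤ δ L ∧ δ L ≤ δb) (hδ0 : Tendsto δ atTop (𝓝 0))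
    (hdataT : ∀ᶠ L in atTop, ∀ (b M : ℕ) [NeZero L] [NeZero (b * L)] [NeZero M], Mth L b ≤ M →
      (∀ x : SrcLabel (b * L) M 0, ∑ y, ‖klBaseTransfer (b * L) M β μ (klFlowFrameU L M β U μ (nScales β + 1)) x y‖ * (1 + ΛT * (Torus.tnorm (x.1.1.2 - y.1.1.1.2) : ℝ)) ≤ cW) ∧
      (∀ y : GridLeg (GridPoint (b * L) (klGridN M)) × Fin 2, ∑ x, ‖klBaseTransfer (b * L) M β μ (klFlowFrameU L M β U μ (nScales β + 1)) x y‖ * (1 + ΛT * (Torus.tnorm (x.1.1.2 - y.1.1.1.2) : ℝ)) ≤ cW) ∧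
      (∀ (δ' β' β₁ : Fin 2 → Fin b) (xbar : SrcLabel L M 0) (y : GridLeg (GridPoint L (klGridN M)) × Fin 2),
        ‖klBaseTransfer (b * L) M β μ (klFlowFrameU L M β U μ (nScales β + 1)) ((klBlockEquivD L b M 0).symm (β' + δ', xbar)) ((klGridBlockEquivD L b M).symm (β₁ + δ', y))‖ =
          ‖klBaseTransfer (b * L) M β μ (klFlowFrameU L M β U μ (nScales β + 1)) ((klBlockEquivD L b M 0).symm (β', xbar)) ((klGridBlockEquivD L b M).symm (β₁, y))‖) ∧
      (∀ x, ∑ y, ‖klBaseTransfer (b * L) M β μ (klFlowFrameU (b * L) M β U μ (nScales β + 1)) x y - klBaseTransfer (b * L) M β μ (klFlowFrameU L M β U μ (nScales β + 1)) x y‖ ≤ δ L) ∧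
      (∀ y, ∑ x, ‖klBaseTransfer (b * L) M β μ (klFlowFrameU (b * L) M β U μ (nScales β + 1)) x y - klBaseTransfer (b * L) M β μ (klFlowFrameU L M β U μ (nScales β + 1)) x y‖ ≤ δ L) ∧
      (∀ (k : ℕ) (p : Fin k) (y : GridLeg (GridPoint L (klGridN M))),
        ∑ Y ∈ univ.filter (fun Y : Fin k → GridLeg (GridPoint L (klGridN M)) => Y p = y),
          ‖kernel ℂ (klGridAction L M β U μ (klFlowFrameU L M β U μ (nScales β + 1))) k Y‖ *
            (1 + labelDiam (fun Y₁ Y₂ : GridLeg (GridPoint L (klGridN M)) => Λg * (Torus.tnorm (Y₁.1.1.2 - Y₂.1.1.2) : ℝ)) (univ.image Y)) ≤ imagTimeWeight β M * NG k) ∧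
      (∀ (k : ℕ) (p : Fin k) (y : GridLeg (GridPoint (b * L) (klGridN M))),
        ∑ Y ∈ univ.filter (fun Y : Fin k → GridLeg (GridPoint (b * L) (klGridN M)) => Y p = y),
          ‖kernel ℂ (klGridAction (b * L) M β U μ (klFlowFrameU (b * L) M β U μ (nScales β + 1))) k Y‖ *
            (1 + labelDiam (fun Y₁ Y₂ : GridLeg (GridPoint (b * L) (klGridN M)) => Λg * (Torus.tnorm (Y₁.1.1.2 - Y₂.1.1.2) : ℝ)) (univ.image Y)) ≤ imagTimeWeight β M * NG k))
    -- the grid data, grid scaling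
    {κE aC cb κ κ' ρS ρ' ρ₂ ρf aw al al' mo mo' s s' Θ νW νf ν₂ νD : ℝ}
    (hκE : 0 < κE) (haC : 0 < aC) (hκ : 0 < κ) (hκ' : 0 < κ') (hρS : 0 < ρS) (hρ' : 0 < ρ') (hρ₂ : 0 < ρ₂) (hρf : 0 < ρf) (haw : 0 < aw)
    (haa : 0 < al' + al) (hm0 : 0 ≤ mo) (hm0' : 0 ≤ mo') (hs0 : 0 ≤ s) (hs'0 : 0 ≤ s') (hΘ0 : 0 ≤ Θ) (hνW0 : 0 ≤ νW) (hνf0 : 0 ≤ νf) (hν₂0 : 0 ≤ ν₂)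
    (hθS : Real.exp 1 * (aC + cb) * νW / κE ^ 2 < 1) (hθΘ : Real.exp 1 * aw * Θ / κ' ^ 2 < 1)
    (hθf : Real.exp 1 * (al' + al + (mo' + mo)) * νf / (κ' + κ) ^ 2 < 1) (hθ₂ : Real.exp 1 * (al' + al + (mo' + mo)) * ν₂ / (κ' + κ + (κ' + κ + (κ' + κ))) ^ 2 < 1)
    (sE cc eE tT Te : ℕ → ℝ) (R R' : ℕ → ℕ)
    (hrate : ∀ L, 0 ≤ sE L ∧ 0 ≤ cc L ∧ 2 * cc L ≤ cb ∧ 0 < tT L ∧ 0 ≤ Te L)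
    (hsE0 : Tendsto sE atTop (𝓝 0)) (hcc0 : Tendsto cc atTop (𝓝 0)) (heE0 : Tendsto eE atTop (𝓝 0)) (htT0 : Tendsto tT atTop (𝓝 0))
    (hTe0 : Tendsto Te atTop (𝓝 0))
    (hq'0 : Tendsto (fun L => ((R' L : ℝ) + 1)⁻¹) atTop (𝓝 0))
    (hRR : ∀ L, R L + R' L ≤ r L)
    (hdata : ∀ᶠ L in atTop, ∀ (b M : ℕ) [NeZero L] [NeZero (b * L)] [NeZero M], Mth L b ≤ M →
      Nonempty (TowerGridDataM L b M β U μ (klFlowFrameU L M β U μ (nScales β + 1)) (klFlowFrameU (b * L) M β U μ (nScales β + 1)) (imagTimeWeight β M) κE aC κ κ' ρS ρ' ρ₂ ρf aw al al' mo mo' s s' Θ νW νf ν₂ νD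
        (sE L) (cc L) (eE L) (tT L) (Te L) (R L) (R' L))) :
    ∀ (k : ℕ) (η : ℝ), 0 < η → ∀ᶠ L in atTop, ∀ (b M : ℕ) [NeZero L] [NeZero (b * L)] [NeZero M], Mth L b ≤ M →
      ∀ (p : Fin k) (w : SrcLabel (b * L) M 0), (∀ i, 2 * r L ≤ (w.1.1.2 i).val % L ∧ (w.1.1.2 i).val % L + 2 * r L < L) →
        klKeyedDefect L b M β U μ (klFlowFrameU L M β U μ (nScales β + 1)) (klFlowFrameU (b * L) M β U μ (nScales β + 1)) 0 k p w ≤ imagTimeWeight β M * η := by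
  classical
  obtain ⟨Kfr, hK⟩ : ∃ Kfr : ℕ → ℕ → TrigPolyC4v, ∀ (V M : ℕ) [NeZero V] [NeZero M], Kfr V M = klFlowFrameU V M β U μ (nScales β + 1) :=
    ⟨fun V M => if hV : V = 0 then 0 else if hM : M = 0 then 0 else
        (haveI : NeZero V := ⟨hV⟩; haveI : NeZero M := ⟨hM⟩; klFlowFrameU V M β U μ (nScales β + 1)),
      fun V M _ _ => by simp only [dif_neg (NeZero.ne V), dif_neg (NeZero.ne M)]⟩
  have hdataT' := hdataT
  have hdata' := hdata
  simp_rw [← hK] at hdataT' hdata' ⊢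
  exact tower_base_h0_eventually_le_mom β U μ hβ Kfr (fun L b M => Mth L b ≤ M) (fun M => imagTimeWeight β M) hMth r hr hΛT hcW hΛg NG hNG0 δ hδ hδ0
    hdataT' hκE haC hκ hκ' hρS hρ' hρ₂ hρf haw haa hm0 hm0' hs0 hs'0 hΘ0 hνW0 hνf0 hν₂0 hθS hθΘ hθf hθ₂ sE cc eE tT Te R R' hrate hsE0 hcc0 heE0 htT0
    hTe0 hq'0 hRR hdata'

end Summit.HubbardSuperconductivity.HubbardSuperconductivity.Theorems.TwoVolumeSource

end
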